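import Mathlib
import HarnessLib

/-!
# `k`-wise independence of polynomial-evaluation hashing over a finite field

The Wegman–Carter family: a key is a coefficient vector `c : Fin k → F` over a finite field `F`, read as the
polynomial `P_c = Σ_{t<k} c_t X^t` of degree `< k`; the hash of a point `u ∈ F` is `P_c(u)` (or one bit `φ(P_c(u))`
of it). For any `j ≤ k` DISTINCT points and any prescribed values, exactly `|F|^{k-j}` keys realise them (Lagrange
interpolation: degree-`< k` polynomials ↔ value vectors on `k` nodes); composing with a BALANCED bit `φ : F → Bool`
gives an exactly `k`-wise independent family of bits: the number of keys realising a bit pattern on `j ≤ k` distinct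
points is `|F|^k / 2^j`.

* `polyKey_eval` — `P_c(u) = Σ_t c_t u^t`;
* `card_filter_polyKey_eval_eq` — `#{c : ∀ u ∈ U, P_c(u) = b u} = |F|^(#s − #U)` for `U ⊆ s`, keys `Fin #s → F`;
* `card_filter_polyKey_bits_mul` — with a balanced bit `φ`, `#{c : ∀ u ∈ U, φ(P_c(u)) = τ u} · 2^{#U} = |F|^{#s}`.

This is the combinatorial half of "explicit `k`-wise independent hash families in `P`" (the evaluation language is a
separate, machine-level statement). [cite: WegmanCarter1981, §3] [cite: AroraBarak2009, Def. 8.14]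
-/

namespace Literature.Computability.Cryptography.PolynomialHash

open Finset Polynomial

variable {F : Type*} [Field F] [Fintype F] [DecidableEq F]

omit [Fintype F] [DecidableEq F] in
/-- The polynomial `P_c = Σ_{t<k} c_t X^t` of a key evaluates as `P_c(u) = Σ_t c_t u^t`. [cite: WegmanCarter1981, §3] -/
theorem polyKey_eval (k : ℕ) (c : Fin k → F) (u : F) :
    (((degreeLTEquiv F k).symm c : degreeLT F k) : F[X]).eval u = ∑ t : Fin k, c t * u ^ (t : ℕ) := by
  set p := (degreeLTEquiv F k).symm c with hp
  have h := eval_eq_sum_degreeLTEquiv (R := F) p.2 u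
  have hc : degreeLTEquiv F k ⟨(p : F[X]), p.2⟩ = c := by
    rw [Subtype.coe_eta, hp, LinearEquiv.apply_symm_apply]
  rw [hc] at h
  exact h

/-- **Interpolation count.** For nodes `U ⊆ s ⊆ F` and prescribed values `b` on `U`, exactly `|F|^(#s − #U)` keys
`c : Fin #s → F` have `P_c(u) = b u` for all `u ∈ U` (degree-`< #s` polynomials are in bijection with their value
vectors on `s`; the values off `U` are free). [cite: WegmanCarter1981, §3] -/
theorem card_filter_polyKey_eval_eq (s U : Finset F) (hU : U ⊆ s) (b : F → F) :
    (univ.filter fun c : Fin #s → F =>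
        ∀ u ∈ U, (((degreeLTEquiv F #s).symm c : degreeLT F #s) : F[X]).eval u = b u).card =
      Fintype.card F ^ (#s - #U) := by
  classical
  -- keys ≃ value vectors on `s`
  let e : (Fin #s → F) ≃ (s → F) :=
    (degreeLTEquiv F #s).symm.toEquiv.trans (Lagrange.funEquivDegreeLT (v := id) (Set.injOn_id _)).toEquiv
  have he : ∀ (c : Fin #s → F) (i : s),
      e c i = (((degreeLTEquiv F #s).symm c : degreeLT F #s) : F[X]).eval (i : F) := fun c i => rfl
  -- the constrained value vectors ≃ free values off `U`
  let T : Finset F := s \ U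
  let f : {r : s → F // ∀ i : s, (i : F) ∈ U → r i = b i} ≃ (T → F) :=
    { toFun := fun r w => r.1 ⟨w, (mem_sdiff.1 w.2).1⟩
      invFun := fun t => ⟨fun i => if hi : (i : F) ∈ U then b i else t ⟨i, mem_sdiff.2 ⟨i.2, hi⟩⟩,
        fun i hi => by simp [hi]⟩
      left_inv := by
        rintro ⟨r, hr⟩
        ext i
        by_cases hi : (i : F) ∈ U
        · simp [hi, hr i hi]
        · simp [hi]
      right_inv := by
        intro t
        funext w
        have hw : (w : F) ∉ U := (mem_sdiff.1 w.2).2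
        simp [hw] }
  -- count
  rw [← Fintype.card_subtype]
  have h1 : Fintype.card {c : Fin #s → F //
      ∀ u ∈ U, (((degreeLTEquiv F #s).symm c : degreeLT F #s) : F[X]).eval u = b u} =
      Fintype.card {r : s → F // ∀ i : s, (i : F) ∈ U → r i = b i} := by
    refine Fintype.card_congr (e.subtypeEquiv fun c => ?_)
    constructor
    · intro h i hi
      rw [he]; exact h i hi
    · intro h u hu
      have := h ⟨u, hU hu⟩ hu
      rwa [he] at this
  rw [h1, Fintype.card_congr f, Fintype.card_fun, Fintype.card_coe]
  congr 1
  exact card_sdiff_of_subset hU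

/-- **Exact `k`-wise independence of the bit family.** If `φ : F → Bool` is balanced (`2·#{φ = true} = |F|`),
then for nodes `U ⊆ s` and any bit pattern `τ` on `U`, the number of keys `c : Fin #s → F` with `φ(P_c(u)) = τ u`
for all `u ∈ U`, times `2^{#U}`, is the number `|F|^{#s}` of all keys. [cite: WegmanCarter1981, §3]
[cite: AroraBarak2009, Def. 8.14] -/
theorem card_filter_polyKey_bits_mul (s U : Finset F) (hU : U ⊆ s) (τ : F → Bool) (φ : F → Bool)
    (hφ : 2 * (univ.filter fun x : F => φ x = true).card = Fintype.card F) :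
    (univ.filter fun c : Fin #s → F =>
        ∀ u ∈ U, φ ((((degreeLTEquiv F #s).symm c : degreeLT F #s) : F[X]).eval u) = τ u).card * 2 ^ #U =
      Fintype.card F ^ #s := by
  classical
  -- both fibres of a balanced bit have `|F|/2` elements
  have hhalf : ∀ bb : Bool, 2 * (univ.filter fun x : F => φ x = bb).card = Fintype.card F := by
    intro bb
    cases bb
    · have hneg : (univ.filter fun x : F => ¬ (φ x = true)) = univ.filter fun x : F => φ x = false := by
        ext x; simp
      have hsplit := Finset.card_filter_add_card_filter_not (s := (univ : Finset F)) (fun x : F => φ x = true)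
      rw [hneg, Finset.card_univ] at hsplit
      omega
    · exact hφ
  -- keys ≃ value vectors on `s` (as in the previous theorem)
  let e : (Fin #s → F) ≃ (s → F) :=
    (degreeLTEquiv F #s).symm.toEquiv.trans (Lagrange.funEquivDegreeLT (v := id) (Set.injOn_id _)).toEquiv
  have he : ∀ (c : Fin #s → F) (i : s),
      e c i = (((degreeLTEquiv F #s).symm c : degreeLT F #s) : F[X]).eval (i : F) := fun c i => rfl
  -- coordinate-wise admissible sets
  let A : s → Finset F := fun i => if (i : F) ∈ U then univ.filter (fun x : F => φ x = τ i) else univ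
  have hcount : (univ.filter fun c : Fin #s → F =>
      ∀ u ∈ U, φ ((((degreeLTEquiv F #s).symm c : degreeLT F #s) : F[X]).eval u) = τ u).card =
      ∏ i : s, (A i).card := by
    rw [← Fintype.card_subtype]
    have h1 : Fintype.card {c : Fin #s → F //
        ∀ u ∈ U, φ ((((degreeLTEquiv F #s).symm c : degreeLT F #s) : F[X]).eval u) = τ u} =
        Fintype.card {r : s → F // ∀ i : s, r i ∈ A i} := by
      refine Fintype.card_congr (e.subtypeEquiv fun c => ?_)
      constructor
      · intro h i
        by_cases hi : (i : F) ∈ U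
        · simp only [A, hi, if_true, mem_filter, mem_univ, true_and]
          rw [he]; exact h i hi
        · simp [A, hi]
      · intro h u hu
        have := h ⟨u, hU hu⟩
        simp only [A, hu, if_true, mem_filter, mem_univ, true_and] at this
        rwa [he] at this
    rw [h1]
    have h2 : Fintype.card {r : s → F // ∀ i : s, r i ∈ A i} = Fintype.card (∀ i : s, (A i : Set F)) := by
      refine Fintype.card_congr ?_
      exact { toFun := fun r i => ⟨r.1 i, by exact_mod_cast r.2 i⟩
              invFun := fun t => ⟨fun i => (t i : F), fun i => by exact_mod_cast (t i).2⟩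
              left_inv := fun r => by ext; rfl
              right_inv := fun t => by funext i; rfl }
    rw [h2, Fintype.card_pi]
    exact Finset.prod_congr rfl fun i _ => by simp
  rw [hcount]
  -- evaluate the product: `|F|/2` on `U`, `|F|` off `U`
  have hA : ∀ i : s, (A i).card * (if (i : F) ∈ U then 2 else 1) = Fintype.card F := by
    intro i
    by_cases hi : (i : F) ∈ U
    · simp only [A, hi, if_true]
      rw [mul_comm]; exact hhalf (τ i)
    · simp [A, hi]
  have hprod : (∏ i : s, (A i).card) * ∏ i : s, (if (i : F) ∈ U then 2 else 1) = Fintype.card F ^ #s := by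
    rw [← Finset.prod_mul_distrib, Finset.prod_congr rfl fun i _ => hA i, Finset.prod_const, Finset.card_univ,
      Fintype.card_coe]
  have htwo : ∏ i : s, (if (i : F) ∈ U then 2 else 1) = 2 ^ #U := by
    rw [Finset.prod_ite, Finset.prod_const_one, mul_one, Finset.prod_const]
    congr 1
    -- the `s`-indices lying in `U` are `#U` many
    rw [show (univ.filter fun i : s => (i : F) ∈ U) = (U.attach.map
        ⟨fun u => ⟨u.1, hU u.2⟩, fun u v h => Subtype.ext (by simpa using congrArg Subtype.val h)⟩) from ?_]
    · rw [card_map, card_attach]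
    · ext i
      simp only [mem_filter, mem_univ, true_and, mem_map, mem_attach, Function.Embedding.coeFn_mk, Subtype.exists]
      constructor
      · intro hi; exact ⟨i.1, hi, Subtype.ext rfl⟩
      · rintro ⟨u, hu, h⟩; rw [← h]; exact hu
  rw [← hprod, htwo]


/-- **`k`-wise independence, intrinsic form.** For any `k ≤ |F|`, any `U ⊆ F` with `#U ≤ k`, any bit pattern `τ` on
`U` and a balanced bit `φ`, the number of keys `c : Fin k → F` with `φ(P_c(u)) = τ u` for all `u ∈ U`, times `2^{#U}`,
equals `|F|^k` (the node set of the previous statement is any `k`-set `s ⊇ U`). [cite: WegmanCarter1981, §3]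
[cite: AroraBarak2009, Def. 8.14] -/
theorem card_filter_polyKey_bits_mul_of_le (k : ℕ) (hk : k ≤ Fintype.card F) (U : Finset F) (hUk : #U ≤ k)
    (τ : F → Bool) (φ : F → Bool) (hφ : 2 * (univ.filter fun x : F => φ x = true).card = Fintype.card F) :
    (univ.filter fun c : Fin k → F =>
        ∀ u ∈ U, φ ((((degreeLTEquiv F k).symm c : degreeLT F k) : F[X]).eval u) = τ u).card * 2 ^ #U =
      Fintype.card F ^ k := by
  classical
  obtain ⟨s, hUs, -, hs⟩ := exists_subsuperset_card_eq (subset_univ U) hUk (by rwa [Finset.card_univ])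
  subst hs
  exact card_filter_polyKey_bits_mul s U hUs τ φ hφ


/-- **Re-keying with uniform fibres.** If keys of an arbitrary finite type `K` are read as coefficient vectors
through a map `κ : K → (Fin k → F)` all of whose fibres have the same size `d` (e.g. a bit string longer than needed,
the surplus bits ignored), the induced bit family is still exactly `k`-wise independent:
`#{key : φ(P_{κ key}(u)) = τ u on U} · 2^{#U} = #K`. [cite: WegmanCarter1981, §3] -/
theorem card_filter_polyKey_bits_mul_rekey {K : Type*} [Fintype K] (k : ℕ) (hk : k ≤ Fintype.card F)
    (κ : K → (Fin k → F)) (d : ℕ) (hκ : ∀ c : Fin k → F, (univ.filter fun key : K => κ key = c).card = d)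
    (U : Finset F) (hUk : #U ≤ k) (τ : F → Bool) (φ : F → Bool)
    (hφ : 2 * (univ.filter fun x : F => φ x = true).card = Fintype.card F) :
    (univ.filter fun key : K =>
        ∀ u ∈ U, φ ((((degreeLTEquiv F k).symm (κ key) : degreeLT F k) : F[X]).eval u) = τ u).card * 2 ^ #U =
      Fintype.card K := by
  classical
  -- abbreviate the pattern predicate on coefficient vectors
  set Pat : (Fin k → F) → Prop := fun c =>
    ∀ u ∈ U, φ ((((degreeLTEquiv F k).symm c : degreeLT F k) : F[X]).eval u) = τ u with hPat
  -- fibrewise: keys with pattern = Σ over pattern vectors of fibre sizes = d · #{c : pattern}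
  have hfib : (univ.filter fun key : K => Pat (κ key)).card = d * (univ.filter fun c : Fin k → F => Pat c).card := by
    rw [card_eq_sum_card_fiberwise (f := κ) (t := univ.filter fun c : Fin k → F => Pat c)
      (fun key hkey => by
        simp only [coe_filter, Set.mem_setOf_eq, mem_univ, true_and] at hkey ⊢
        exact hkey)]
    rw [Finset.sum_const_nat (m := d) fun c hc => ?_]
    · ring
    · rw [← hκ c]
      congr 1
      ext key
      simp only [mem_filter, mem_univ, true_and]
      constructor
      · rintro ⟨_, h⟩; exact h
      · intro h
        refine ⟨?_, h⟩
        rw [h]; exact (mem_filter.1 hc).2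
  -- total: #K = d · |F|^k
  have htot : Fintype.card K = d * Fintype.card F ^ k := by
    rw [← Finset.card_univ, card_eq_sum_card_fiberwise (f := κ) (t := (univ : Finset (Fin k → F)))
      (fun _ _ => mem_univ _), Finset.sum_const_nat (m := d) fun c _ => hκ c, Finset.card_univ, Fintype.card_fun,
      Fintype.card_fin]
    ring
  have hmain := card_filter_polyKey_bits_mul_of_le (F := F) k hk U hUk τ φ hφ
  rw [hfib, htot, mul_assoc, hmain]

end Literature.Computability.Cryptography.PolynomialHash
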